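import Literature.NumberTheory.ComplexMultiplication.CMOrderMaximalOrderGeneratorsCount
import Literature.NumberTheory.ComplexMultiplication.CMOrderCohenMacaulayTypeGenerators
import Literature.NumberTheory.ComplexMultiplication.CMOrderPicardToClassGroup
import Literature.NumberTheory.ComplexMultiplication.CMTorusIsomorphismClassesMaximalEndomorphismRingCount
import Literature.Geometry.Kaehler.ComplexTorusInvertibleIdealDegree
import Mathlib.RingTheory.DedekindDomain.Ideal.Lemmas
import HarnessLib

/-!
# Greither's inequality `dim_{S/𝔭} I/𝔭I ≤ dim_{S/𝔭} 𝒪_K/𝔭𝒪_K` at a prime with a superficial element (GREITHER 1982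
# THEOREM 2.1, `v(R) ≤ e(R) = [S/mS : R/m]`, elementary case), superficial elements under binary branching, and
# MARSEGLIA 2024 LEMMA 4.3 / COROLLARY 4.4 `gens(S) = gens_S(𝒪_K)` for orders with binary branching

Family `hodge`, lane `lit-hodgefound` (Track 2 foundations library; seat p15, row g29-#1), topic
`Literature/NumberTheory/ComplexMultiplication`, namespaces `Literature.NumberTheory.ComplexMultiplication.NumberRing`
(§1: any domain `R` with fraction field `K`; §3: any Dedekind domain `D`), `…EndOrder` (§4: the order `𝔯 = endOrder ρ`
of a number field of any degree and its inclusion `toRingOfIntegers ρ : 𝔯 → 𝓞 K`) and `…CMTypeLattice` (§§2, 5: the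
order `S = endOrder (M_μ)` of a `ℚ`-basis `μ` of `K`, `#ι = [K:ℚ]`).  Vocabulary (no new definition): the maximal order
is the idempotent `M` with `↑M = range (algebraMap (𝓞 K) K)`; `gens_S(I)` is `Submodule.spanFinrank ↑I`
(`CMOrderIdealGeneratorsCount`, LEMMA 4.2); `gens(S) = ⨆_{I ≠ 0} gens_S(I)` (`CMOrderCohenMacaulayTypeGenerators`, DEF. 4.1);
the `S/𝔭`-space `I/𝔭I` is `↥↑I ⧸ 𝔭 • ⊤`; the `𝔭`-PRIMARY PART `𝔞_(𝔭) = 𝔞S_𝔭 ∩ S` of an ideal is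
`(𝔞.map (algebraMap S S_𝔭)).comap (algebraMap S S_𝔭)` with Mathlib's `Localization.AtPrime`
(`CMOrderPrimaryDecomposition`, `CMOrderInvertibleIdealLocalization`); a SUPERFICIAL ELEMENT of `𝔭` (for `𝒪_K`) is an
`x ∈ 𝔭` with `𝔭𝒪_K ⊆ x𝒪_K + 𝔭²𝒪_K`, i.e. `x𝒪_{K,𝔭} = 𝔭𝒪_{K,𝔭}`; BINARY BRANCHING at `𝔭` («over `𝔭` there are at most
two primes of `𝒪_K`») is the statement that among any three maximal ideals of `𝓞 K` above `𝔭𝒪_K` two coincide.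
THEOREMS ONLY: no definition, no instance, no named fact (net Literature debt `0`).

## Sources, VERBATIM

C. Greither, *On the two generator problem for the ideals of a one-dimensional ring*, J. Pure Appl. Algebra 24
(1982) 265–276 [Greither1982TwoGenerator] (held `paper:doi-10-1016-0022-4049-82-90044-5`):
* p. 267 (chunk p0003): "We always suppose `R` onedimensional, reduced, and `S` (its normalization) finite over
  `R`. For local rings `R` and any ideal `I`, we set `v(I) :=` minimal number of generators for `I`. Moreover,
  `v(R) :=` the maximum of all `v(I)`, `I ⊂ R`. […] 2.1. THEOREM. Let `R` be local. Then `v(R) = e(R)` (the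
  multiplicity of `R`, see [5]) `= [S/mS : R/m]` (minimal number of generators for the `R`-module `S`).  Proof.
  `e(R) = lim_{n→∞} [mⁿ/mⁿ⁺¹ : R/m] ≤ v(R)`. Since `R` is Cohen-Macaulay, we also have `v(R) ≤ e(R)` by [5, p. 49]. It
  remains to show that `e(R) = [S/mS : R/m]`. As `S` is normal and onedimensional, every nonzero ideal of `S` is a
  product of maximal ideals, so we get: `mS = ∏_{i=1}^t n_i^{e_i}`, `Max(S) = {n_1, …, n_t}`. By the Chinese
  Remainder Theorem, `[S/mS : R/m] = Σ_i e_i·[S/n_i : R/m]` […]"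
* p. 268 (chunk p0004): "2.2. COROLLARY. For `R` not necessarily local, we have `v(R) ≤ max(2, minimal number of
  generators of S as an R-module)`, and if `v(R) ≠ 1` (i.e. `R` not a product of PID's), we have equality. […]
  2.3. THEOREM. Let us say `R` has binary branching if over every `p ∈ Spec(R)` there are at most two primes of
  `S`. The following conditions are equivalent: (a) `R` is a Q-ring, i.e. `S` is a quadratic extension of `R`. […]
  (c) `R` is IG₂, i.e. `v(R)` is at most two. […] (e) Every ring between `R` and `S` is Gorenstein."

S. Marseglia, *Cohen-Macaulay type of orders, generators and ideal classes*, J. Algebra 658 (2024) 247–276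
[Marseglia2024CMType] (arXiv:2206.03758, held `paper:arxiv-2206.03758`), §4, chunk p0010: "It is known that,
among all fractional `S`-ideals, the one that requires the biggest number of generators is `𝒪_K`.  Lemma 4.3
([Greither82]). Let `S` be an order. Then `gens(S) ≤ max{2, gens_S(𝒪_K)}`. The inequality is strict if and only if
`S = 𝒪_K` and `𝒪_K` is a product of PID, that is, `K` has class number one.  Corollary 4.4. Let `S` be a
non-maximal order. Then `gens(S) = gens_S(𝒪_K) = max{dim_{S/𝔭}(𝒪_K/𝔭𝒪_K) : 𝔭 prime of S}`.  Proof. Since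
`S ≠ 𝒪_K` then `gens_S(𝒪_K) ≥ 2`. The first equality follows from Lemma 4.3 and the second follows from Lemma 4.2.
[…] Proposition 4.5. […] In particular, if `S` is not maximal then `gens(S) = 1 + max{type(S + 𝔭𝒪_K) : 𝔭 a prime
of S}`."

## What is formalised, and how it deviates from the printed proofs

Greither's proof of THEOREM 2.1 runs through the Hilbert–Samuel multiplicity `e(R)` and Sally's bound `v(I) ≤ e(R)`
for one-dimensional Cohen–Macaulay local rings ([5, p. 49]), neither of which is in Mathlib.  The classical argument
behind `v(I) ≤ e(R)` is `v(I) = ℓ(I/mI) ≤ ℓ(I/xI) = ℓ(R/xR) = e(R)` for a superficial element `x` of `m` (one with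
`xS = mS` locally), which exists after an extension of the residue field; and Greither's computation
`e(R) = Σ eᵢ fᵢ = [S/mS : R/m]` is exactly `ℓ(S/xS)` for such an `x`.  This file proves that chain DIRECTLY for the
orders of a number field, at every prime `𝔭` of `S` that carries a superficial element `x ∈ 𝔭` — no residue field
extension —, the lattice-independence of the index `#(L/𝔮L)` of the INVERTIBLE `𝔭`-primary ideal `𝔮 = (xS)_(𝔭)`
(`𝔮S_𝔭 = xS_𝔭`, `𝔮S_𝔮' = S_𝔮'` for `𝔮' ≠ 𝔭`; the tree's `NumberRing.isUnit_coeIdeal_comap_map_span_singleton`)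
replacing the local length `ℓ(L_𝔭/xL_𝔭)` (the tree's `InvertibleIdealIndex.relIndex_smul_eq_relIndex_smul`,
Stevenhagen §7): `#(I/𝔭I) ≤ #(I/𝔮I) = #(𝒪_K/𝔮𝒪_K) = #(𝒪_K/𝔭𝒪_K)` since `𝔮𝒪_K = 𝔭𝒪_K`.  Superficial elements are
shown to exist whenever at most two primes of `𝒪_K` lie over `𝔭` (Greither's «binary branching», THM. 2.3): in
the Dedekind domain `𝓞 K`, if no `x ∈ 𝔭` works then every `x ∈ 𝔭` lies in `𝔭𝒪_K·𝔔` for one of the (at most two)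
primes `𝔔 ⊇ 𝔭𝒪_K`, and `𝔭` would be a union of two proper subgroups.  (With finite residue fields a superficial
element inside `𝔭` need not exist when three or more primes lie over `𝔭`; the general case of LEMMA 4.3 is NOT
formalised here.)

* §1 (`NumberRing`, any domain `R`): `coeIdeal_mul_le_add_pow_mul` (`𝔭M ⊆ 𝔞M + 𝔭²M ⟹ 𝔭M ⊆ 𝔞M + 𝔭ⁿ⁺²M`),
  **`coeIdeal_comap_map_span_singleton_mul_eq`** (`(xR)_(𝔭)·M = 𝔭M` for a superficial `x`, `R` noetherian of
  dimension `≤ 1`: `(xR)_(𝔭) ⊇ 𝔭ⁿ`, LEMMA 5.1 of Stevenhagen = `CMOrderPrimaryDecomposition.exists_pow_le_comap_map`).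
* §2 (`CMTypeLattice`, `S = endOrder (M_μ)`): `natCard_quotient_comap_ne_zero` (two nonzero fractional ideals
  `J ⊆ I` have finite index, `CMLatticeTraceDualIndex`), **`natCard_quotient_smul_top_eq_of_le` /
  `natCard_quotient_smul_top_eq_of_isUnit`** (`#(I/𝔮I) = #(J/𝔮J)` for an invertible ideal `𝔮` and any two nonzero
  fractional ideals), and **GREITHER'S LOCAL INEQUALITY `finrank_quotient_smul_top_le_of_superficial`:
  `dim_{S/𝔭} I/𝔭I ≤ dim_{S/𝔭} 𝒪_K/𝔭𝒪_K` for every `I ≠ 0` at a prime `𝔭` with a superficial element.**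
* §3 (`NumberRing`, any Dedekind domain `D`, any ring map `f : R → D`, `J = 𝔭D`): `le_span_singleton_sup_sq_or_exists_mem_mul`
  (for `s ∈ 𝔭`: either `J ⊆ f(s)D + J²` or `f(s) ∈ J𝔔` for a maximal `𝔔 ⊇ J`), `exists_mem_map_not_mem_mul` (no
  maximal `𝔔` has `f(𝔭) ⊆ J𝔔`), **`exists_mem_map_le_span_singleton_sup_sq`** (binary branching over `J ≠ 0` ⟹ a
  superficial element `x ∈ 𝔭`: `J ⊆ f(x)D + J²`).
* §4 (`EndOrder`, `𝔯 = endOrder ρ`, transport along the tree's `EndOrder.extend ρ : I ↦ I𝒪_K`):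
  `extend_eq_one_of_coe_eq_range` (`M𝒪_K = 𝒪_K`), `le_of_extend_le_extend` (`𝒪_K`-stable ideals compare through
  their extensions), `coeIdeal_mul_le_of_map_le_span_singleton_sup_sq`, `map_toRingOfIntegers_ne_bot`, and
  **`exists_mem_coeIdeal_mul_le_of_binaryBranching`** (binary branching at `𝔭 ≠ 0` ⟹ `∃ x ∈ 𝔭`,
  `𝔭M ⊆ xM + 𝔭²M`).
* §5 (`CMTypeLattice`): **`finrank_quotient_smul_top_le_of_binaryBranching`** (THEOREM 2.1's `v(I) ≤ [S/mS : R/m]`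
  at a prime with binary branching), **MARSEGLIA LEMMA 4.3 `spanFinrank_coe_le_max_of_binaryBranching`:
  `gens_S(I) ≤ max{2, gens_S(𝒪_K)}`** and **COROLLARY 4.4 `iSup_spanFinrank_coe_eq_spanFinrank_coe_of_binaryBranching`:
  `gens(S) = gens_S(𝒪_K)`** (`S ≠ 𝒪_K`), `iSup_spanFinrank_coe_eq_iSup_finrank_quotient_smul_top_of_binaryBranching`
  (`gens(S) = max_𝔭 dim_{S/𝔭} 𝒪_K/𝔭𝒪_K`, with g28-#8) and PROPOSITION 4.5 «In particular» AS PRINTED,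
  `exists_not_isUnit_forall_iSup_add_one_eq_iSup_spanFinrank_of_binaryBranching` (`gens(S) = 1 + type(S + 𝔭𝒪_K)` at
  a maximising non-invertible prime) — all for orders with binary branching at their non-invertible primes.
-/

noncomputable section

open scoped nonZeroDivisors NumberField
open NumberField Module FractionalIdeal
open Submodule (traceDual)

namespace Literature.NumberTheory.ComplexMultiplication

namespace NumberRing

/-! ## §1 Superficial elements and the invertible `𝔭`-primary ideal `𝔮 = (xR)_(𝔭)` with `𝔮M = 𝔭M` -/

section AnyDomain

variable {R : Type*} [CommRing R] [IsDomain R] {K : Type*} [Field K] [Algebra R K] [IsFractionRing R K]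

omit [IsDomain R] [IsFractionRing R K] in
/-- **Iterating the superficial relation: `𝔭M ⊆ 𝔞M + 𝔭²M ⟹ 𝔭M ⊆ 𝔞M + 𝔭ⁿ⁺²M` for every `n`** (substitute the
relation into its own error term: `𝔭²M = 𝔭(𝔭M) ⊆ 𝔭𝔞M + 𝔭ⁿ⁺³M ⊆ 𝔞M + 𝔭ⁿ⁺³M`; the step «`mⁿ⁺¹ = x mⁿ` for a
superficial element» of the multiplicity argument). [cite: Greither1982TwoGenerator, §2 Thm. 2.1 (proof: `e(R)`,
«Since `R` is Cohen-Macaulay, we also have `v(R) ≤ e(R)`»), p. 267] -/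
theorem coeIdeal_mul_le_add_pow_mul {𝔭 𝔞 : Ideal R} {M : FractionalIdeal R⁰ K}
    (h : (𝔭 : FractionalIdeal R⁰ K) * M ≤ (𝔞 : FractionalIdeal R⁰ K) * M + (𝔭 : FractionalIdeal R⁰ K) ^ 2 * M)
    (n : ℕ) :
    (𝔭 : FractionalIdeal R⁰ K) * M ≤ (𝔞 : FractionalIdeal R⁰ K) * M + (𝔭 : FractionalIdeal R⁰ K) ^ (n + 2) * M := by
  induction n with
  | zero => exact h
  | succ n ih =>
    rw [← sup_eq_add] at h ih ⊢
    -- `𝔭²M = 𝔭(𝔭M) ≤ 𝔭(𝔞M ⊔ 𝔭^(n+2)M) = 𝔭𝔞M ⊔ 𝔭^(n+3)M ≤ 𝔞M ⊔ 𝔭^(n+3)M`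
    have h2 : (𝔭 : FractionalIdeal R⁰ K) ^ 2 * M ≤
        (𝔞 : FractionalIdeal R⁰ K) * M ⊔ (𝔭 : FractionalIdeal R⁰ K) ^ (n + 1 + 2) * M := by
      have e1 : (𝔭 : FractionalIdeal R⁰ K) ^ 2 * M = (𝔭 : FractionalIdeal R⁰ K) * ((𝔭 : FractionalIdeal R⁰ K) * M) := by
        rw [pow_two, mul_assoc]
      have e2 : (𝔭 : FractionalIdeal R⁰ K) * ((𝔭 : FractionalIdeal R⁰ K) ^ (n + 2) * M) =
          (𝔭 : FractionalIdeal R⁰ K) ^ (n + 1 + 2) * M := by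
        rw [← mul_assoc, ← pow_succ', show n + 2 + 1 = n + 1 + 2 by ring]
      rw [e1]
      refine (mul_le_mul_right ih (𝔭 : FractionalIdeal R⁰ K)).trans ?_
      rw [sup_eq_add, mul_add, ← sup_eq_add, e2]
      refine sup_le_sup_right ?_ _
      calc (𝔭 : FractionalIdeal R⁰ K) * ((𝔞 : FractionalIdeal R⁰ K) * M)
          ≤ 1 * ((𝔞 : FractionalIdeal R⁰ K) * M) := mul_le_mul_left coeIdeal_le_one _
        _ = (𝔞 : FractionalIdeal R⁰ K) * M := one_mul _
    exact h.trans (sup_le le_sup_left h2)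

/-- **The `𝔭`-primary part `𝔮 = (xR)_(𝔭) = xR_𝔭 ∩ R` of a superficial element satisfies `𝔮M = 𝔭M`** (`R` a
noetherian domain of dimension `≤ 1`, `𝔭` maximal, `0 ≠ x ∈ 𝔭` with `𝔭M ⊆ xM + 𝔭²M`): `𝔮 ⊆ 𝔭` gives `⊆`, and
`𝔮 ⊇ xR + 𝔭ⁿ` (LEMMA 5.1 of Stevenhagen: `(xR)_(𝔭) ⊇ 𝔭ⁿ`) with `𝔭M ⊆ xM + 𝔭ⁿM` gives `⊇` — the fractional-ideal
form of «`xS = mS`» for the ideal `𝔮` whose localisations are `xS_𝔭` at `𝔭` and trivial elsewhere.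
[cite: Greither1982TwoGenerator, §2 Thm. 2.1 (proof: «`mS = ∏ nᵢ^{eᵢ}` … `[S/mS : R/m] = Σ eᵢ·[S/nᵢ : R/m]`»), p. 267]
[cite: Stevenhagen2008NumberRings, §5 Lemma 5.1 and «the `𝔭`-primary part `I_(𝔭)` of a nonzero ideal contains some
power of `𝔭`», p. 218] -/
theorem coeIdeal_comap_map_span_singleton_mul_eq [IsNoetherianRing R] [Ring.DimensionLEOne R]
    {𝔭 : Ideal R} [h𝔭 : 𝔭.IsMaximal] {x : R} (hx0 : x ≠ 0) (hx : x ∈ 𝔭) {M : FractionalIdeal R⁰ K}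
    (h : (𝔭 : FractionalIdeal R⁰ K) * M ≤
      ((Ideal.span {x} : Ideal R) : FractionalIdeal R⁰ K) * M + (𝔭 : FractionalIdeal R⁰ K) ^ 2 * M) :
    ((((Ideal.span {x} : Ideal R).map (algebraMap R (Localization.AtPrime 𝔭))).comap
        (algebraMap R (Localization.AtPrime 𝔭)) : Ideal R) : FractionalIdeal R⁰ K) * M =
      (𝔭 : FractionalIdeal R⁰ K) * M := by
  set 𝔮 : Ideal R := ((Ideal.span {x} : Ideal R).map (algebraMap R (Localization.AtPrime 𝔭))).comap
    (algebraMap R (Localization.AtPrime 𝔭)) with h𝔮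
  have hq𝔭 : 𝔮 ≤ 𝔭 := comap_map_le_of_le ((Ideal.span_singleton_le_iff_mem _).2 hx)
  refine le_antisymm (mul_le_mul_left (coeIdeal_le_coeIdeal K |>.2 hq𝔭) _) ?_
  obtain ⟨n, hn⟩ := exists_pow_le_comap_map (I := Ideal.span {x})
    (by rwa [Ne, Ideal.span_singleton_eq_bot]) 𝔭
  have hx𝔮 : Ideal.span {x} ≤ 𝔮 := le_comap_map _ _
  have hpow : 𝔭 ^ (n + 2) ≤ 𝔮 := (Ideal.pow_le_pow_right (by omega)).trans hn
  calc (𝔭 : FractionalIdeal R⁰ K) * M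
      ≤ ((Ideal.span {x} : Ideal R) : FractionalIdeal R⁰ K) * M + (𝔭 : FractionalIdeal R⁰ K) ^ (n + 2) * M :=
        coeIdeal_mul_le_add_pow_mul h n
    _ ≤ (𝔮 : FractionalIdeal R⁰ K) * M + (𝔮 : FractionalIdeal R⁰ K) * M := by
        rw [← coeIdeal_pow]
        exact add_le_add (mul_le_mul_left (coeIdeal_le_coeIdeal K |>.2 hx𝔮) _)
          (mul_le_mul_left (coeIdeal_le_coeIdeal K |>.2 hpow) _)
    _ = (𝔮 : FractionalIdeal R⁰ K) * M := by rw [← sup_eq_add, sup_idem]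

end AnyDomain

end NumberRing

namespace CMTypeLattice

/-! ## §2 The index of `𝔮L` in `L` is lattice-independent for invertible `𝔮`; GREITHER'S LOCAL INEQUALITY -/

section LocalInequality

variable {K : Type} [Field K] [NumberField K]
variable {ι : Type} [Fintype ι] [DecidableEq ι] (μ : Basis ι ℚ K) [Nonempty ι]
variable [IsFractionRing (endOrder (Algebra.leftMulMatrix μ)) K]

omit [Nonempty ι] [IsFractionRing (endOrder (Algebra.leftMulMatrix μ)) K] in
/-- **Two nonzero fractional ideals `J ⊆ I` of the order `S = endOrder (M_μ)` have finite index `#(I/J) ≠ 0`** (both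
are full `ℤ`-lattices `⊕ ℤνⱼ`, `⊕ ℤν'ⱼ` of `K`, and `#(I/J) = |det_ν(ν')| ≠ 0`, `CMLatticeTraceDualIndex`).
[cite: Marseglia2024CMType, §2.3 Lemma 2.4 (iv) (proof: «`M = I/J` […] has finite length»), p. 6]
[cite: Stevenhagen2008NumberRings, §7 («`[R : M_x[R]] = |det M|`»), p. 231] -/
theorem natCard_quotient_comap_ne_zero {I J : FractionalIdeal (endOrder (Algebra.leftMulMatrix μ))⁰ K}
    (hI : I ≠ 0) (hJ : J ≠ 0)
    (h : (J : Submodule (endOrder (Algebra.leftMulMatrix μ)) K) ≤ (I : Submodule (endOrder (Algebra.leftMulMatrix μ)) K)) :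
    Nat.card (↥(I : Submodule (endOrder (Algebra.leftMulMatrix μ)) K) ⧸
      (J : Submodule (endOrder (Algebra.leftMulMatrix μ)) K).comap
        (I : Submodule (endOrder (Algebra.leftMulMatrix μ)) K).subtype) ≠ 0 := by
  classical
  obtain ⟨ν, hν⟩ := exists_basis_span_eq_restrictScalars_coe μ hI
  obtain ⟨ν', hν'⟩ := exists_basis_span_eq_restrictScalars_coe μ hJ
  have h' : Submodule.span ℤ (Set.range ν') ≤ Submodule.span ℤ (Set.range ν) := by
    rw [hν, hν']
    exact fun x hx ↦ h hx
  have key := natCard_quotient_comap_span_eq_abs_det ν ν' h'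
  rw [hν, hν', natCard_quotient_comap_restrictScalars μ] at key
  intro h0
  rw [h0, Nat.cast_zero, eq_comm, abs_eq_zero] at key
  exact (ν.isUnit_det ν').ne_zero key

omit [Nonempty ι] in
/-- **`#(J/𝔮J) = #(I/𝔮I)` for an INVERTIBLE ideal `𝔮` of `S` and nonzero fractional ideals `J ⊆ I`** — the ideal
norm of an invertible ideal does not depend on the lattice it is computed in: `[I : 𝔮I]·… = [I : 𝔮J] = [I : J][J : 𝔮J]`
and `[𝔮I : 𝔮J] = [I : J]` (the tree's `InvertibleIdealIndex.relIndex_smul_eq_relIndex_smul`, with `𝔮𝔮' = (d)`).  This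
replaces the local length `ℓ(L_𝔭/xL_𝔭) = ℓ(R/xR)`, independent of the lattice `L`, of the multiplicity argument.
[cite: Stevenhagen2008NumberRings, §7 («The index map `I ↦ [R:I]` … extends to a multiplicative map `𝓘(R) → ℚ^*` on
invertible ideals known as the ideal norm»), p. 231] [cite: Greither1982TwoGenerator, §2 Thm. 2.1 (proof: `v(R) ≤ e(R)`),
p. 267] -/
theorem natCard_quotient_smul_top_eq_of_le {𝔮 : Ideal (endOrder (Algebra.leftMulMatrix μ))}
    (h𝔮 : IsUnit (𝔮 : FractionalIdeal (endOrder (Algebra.leftMulMatrix μ))⁰ K))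
    {I J : FractionalIdeal (endOrder (Algebra.leftMulMatrix μ))⁰ K} (hI : I ≠ 0) (hJ : J ≠ 0) (h : J ≤ I) :
    Nat.card (↥(J : Submodule (endOrder (Algebra.leftMulMatrix μ)) K) ⧸
        (𝔮 • ⊤ : Submodule (endOrder (Algebra.leftMulMatrix μ)) (J : Submodule (endOrder (Algebra.leftMulMatrix μ)) K))) =
      Nat.card (↥(I : Submodule (endOrder (Algebra.leftMulMatrix μ)) K) ⧸
        (𝔮 • ⊤ : Submodule (endOrder (Algebra.leftMulMatrix μ)) (I : Submodule (endOrder (Algebra.leftMulMatrix μ)) K))) := by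
  obtain ⟨𝔮', d, hd, hqq'⟩ :=
    (Literature.Geometry.Kaehler.ComplexTorus.isUnit_coeIdeal_iff_exists_mul_eq_span K).1 h𝔮
  have hdK : IsSMulRegular K d := fun a b hab ↦ by
    simp only [Subring.smul_def, smul_eq_mul] at hab
    exact mul_left_cancel₀ (by exact_mod_cast hd) hab
  have hle : (J : Submodule (endOrder (Algebra.leftMulMatrix μ)) K) ≤ (I : Submodule (endOrder (Algebra.leftMulMatrix μ)) K) :=
    coe_le_coe.2 h
  have hfin := natCard_quotient_comap_ne_zero μ hI hJ hle
  rw [natCard_quotient_comap_eq_relIndex] at hfin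
  have key := Literature.Geometry.Kaehler.ComplexTorus.InvertibleIdealIndex.relIndex_smul_eq_relIndex_smul (M := K)
    (fun a b ↦ mul_comm a b) (mem_nonZeroDivisors_of_ne_zero hd) hdK hqq' hle hfin
  rw [← natCard_quotient_comap_coeIdeal_mul μ 𝔮 J, ← natCard_quotient_comap_coeIdeal_mul μ 𝔮 I,
    natCard_quotient_comap_eq_relIndex, natCard_quotient_comap_eq_relIndex, NumberRing.coe_coeIdeal_mul,
    NumberRing.coe_coeIdeal_mul, key]

omit [Nonempty ι] in
/-- **`#(I/𝔮I) = #(J/𝔮J)` for an invertible ideal `𝔮` and ANY two nonzero fractional ideals `I`, `J`** (compare both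
with `I + J`). [cite: Stevenhagen2008NumberRings, §7 (the ideal norm on `𝓘(R)`), p. 231]
[cite: Greither1982TwoGenerator, §2 Thm. 2.1 (proof), p. 267] -/
theorem natCard_quotient_smul_top_eq_of_isUnit {𝔮 : Ideal (endOrder (Algebra.leftMulMatrix μ))}
    (h𝔮 : IsUnit (𝔮 : FractionalIdeal (endOrder (Algebra.leftMulMatrix μ))⁰ K))
    {I J : FractionalIdeal (endOrder (Algebra.leftMulMatrix μ))⁰ K} (hI : I ≠ 0) (hJ : J ≠ 0) :
    Nat.card (↥(I : Submodule (endOrder (Algebra.leftMulMatrix μ)) K) ⧸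
        (𝔮 • ⊤ : Submodule (endOrder (Algebra.leftMulMatrix μ)) (I : Submodule (endOrder (Algebra.leftMulMatrix μ)) K))) =
      Nat.card (↥(J : Submodule (endOrder (Algebra.leftMulMatrix μ)) K) ⧸
        (𝔮 • ⊤ : Submodule (endOrder (Algebra.leftMulMatrix μ)) (J : Submodule (endOrder (Algebra.leftMulMatrix μ)) K))) := by
  have hIJ : I + J ≠ 0 := fun h0 ↦ hI (le_bot_iff.1 ((le_self_add (a := I) (b := J)).trans h0.le))
  rw [natCard_quotient_smul_top_eq_of_le μ h𝔮 hIJ hI le_self_add,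
    natCard_quotient_smul_top_eq_of_le μ h𝔮 hIJ hJ le_add_self]

/-- **GREITHER'S LOCAL INEQUALITY (THEOREM 2.1, `v(I) ≤ e(R) = [S/mS : R/m]`, at a prime with a superficial element):
for the order `S = endOrder (M_μ)`, the maximal order `M` (`↑M = 𝒪_K`), a maximal ideal `𝔭` of `S` and `x ∈ 𝔭` with
`𝔭𝒪_K ⊆ x𝒪_K + 𝔭²𝒪_K`, every nonzero fractional ideal `I` has `dim_{S/𝔭} I/𝔭I ≤ dim_{S/𝔭} 𝒪_K/𝔭𝒪_K`.**  Proof: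
`x ≠ 0` (else `𝔭𝒪_K = 𝔭(𝔭𝒪_K)`, Nakayama); with the invertible ideal `𝔮 = (xS)_(𝔭) ⊆ 𝔭`, `𝔮𝒪_K = 𝔭𝒪_K` (§1):
`#(I/𝔭I) ≤ #(I/𝔮I) = #(𝒪_K/𝔮𝒪_K) = #(𝒪_K/𝔭𝒪_K)`, i.e. `q^{dim I/𝔭I} ≤ q^{dim 𝒪_K/𝔭𝒪_K}` with `q = #(S/𝔭) > 1`.
[cite: Greither1982TwoGenerator, §2 Thm. 2.1 («`v(R) = e(R) = [S/mS : R/m]`» and proof), p. 267]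
[cite: Marseglia2024CMType, §4 Lemma 4.3 ([Greither82]: «among all fractional `S`-ideals, the one that requires the
biggest number of generators is `𝒪_K`»), p. 10] -/
theorem finrank_quotient_smul_top_le_of_superficial {M : FractionalIdeal (endOrder (Algebra.leftMulMatrix μ))⁰ K}
    (hMO : (M : Set K) = (algebraMap (𝓞 K) K).range) {𝔭 : Ideal (endOrder (Algebra.leftMulMatrix μ))}
    [h𝔭 : 𝔭.IsMaximal] {x : endOrder (Algebra.leftMulMatrix μ)} (hx : x ∈ 𝔭)
    (hsup : (𝔭 : FractionalIdeal (endOrder (Algebra.leftMulMatrix μ))⁰ K) * M ≤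
      ((Ideal.span {x} : Ideal (endOrder (Algebra.leftMulMatrix μ))) :
        FractionalIdeal (endOrder (Algebra.leftMulMatrix μ))⁰ K) * M +
        (𝔭 : FractionalIdeal (endOrder (Algebra.leftMulMatrix μ))⁰ K) ^ 2 * M)
    {I : FractionalIdeal (endOrder (Algebra.leftMulMatrix μ))⁰ K} (hI : I ≠ 0) :
    Module.finrank (endOrder (Algebra.leftMulMatrix μ) ⧸ 𝔭)
        (↥(I : Submodule (endOrder (Algebra.leftMulMatrix μ)) K) ⧸
          (𝔭 • ⊤ : Submodule (endOrder (Algebra.leftMulMatrix μ)) (I : Submodule (endOrder (Algebra.leftMulMatrix μ)) K))) ≤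
      Module.finrank (endOrder (Algebra.leftMulMatrix μ) ⧸ 𝔭)
        (↥(M : Submodule (endOrder (Algebra.leftMulMatrix μ)) K) ⧸
          (𝔭 • ⊤ : Submodule (endOrder (Algebra.leftMulMatrix μ)) (M : Submodule (endOrder (Algebra.leftMulMatrix μ)) K))) := by
  haveI := isNoetherianRing_endOrder (Algebra.leftMulMatrix μ)
  haveI := dimensionLEOne_endOrder (Algebra.leftMulMatrix μ)
  have h0 : 𝔭 ≠ ⊥ := Ring.ne_bot_of_isMaximal_of_not_isField h𝔭 EndOrder.not_isField
  have hM0 : M ≠ 0 := ne_zero_of_coe_eq_range μ hMO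
  have hP0 : (𝔭 : FractionalIdeal (endOrder (Algebra.leftMulMatrix μ))⁰ K) ≠ 0 := coeIdeal_ne_zero.2 h0
  -- `x ≠ 0`: otherwise `𝔭M ≤ 𝔭²M = 𝔭(𝔭M)`, against Nakayama (`𝔭M ∋ p·1 ≠ 0`)
  have hx0 : x ≠ 0 := by
    rintro rfl
    have hle : (𝔭 : FractionalIdeal (endOrder (Algebra.leftMulMatrix μ))⁰ K) * M ≤
        (𝔭 : FractionalIdeal (endOrder (Algebra.leftMulMatrix μ))⁰ K) *
          ((𝔭 : FractionalIdeal (endOrder (Algebra.leftMulMatrix μ))⁰ K) * M) := by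
      have h' := hsup
      rw [Ideal.span_singleton_zero, coeIdeal_bot, zero_mul, zero_add, pow_two, mul_assoc] at h'
      exact h'
    have hge : (𝔭 : FractionalIdeal (endOrder (Algebra.leftMulMatrix μ))⁰ K) *
          ((𝔭 : FractionalIdeal (endOrder (Algebra.leftMulMatrix μ))⁰ K) * M) ≤
        (𝔭 : FractionalIdeal (endOrder (Algebra.leftMulMatrix μ))⁰ K) * M :=
      (mul_le_mul_left coeIdeal_le_one _).trans (one_mul _).le
    have heq := le_antisymm hge hle
    obtain ⟨-, h1M⟩ := EndOrder.mul_self_le_and_one_mem_of_coe_eq_range hMO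
    obtain ⟨p, hp𝔭, hp0⟩ := Submodule.exists_mem_ne_zero_of_ne_bot h0
    have hPM0 : (((𝔭 : FractionalIdeal (endOrder (Algebra.leftMulMatrix μ))⁰ K) * M :
        FractionalIdeal (endOrder (Algebra.leftMulMatrix μ))⁰ K) : Submodule (endOrder (Algebra.leftMulMatrix μ)) K) ≠ ⊥ := by
      intro hb
      have hmem : algebraMap (endOrder (Algebra.leftMulMatrix μ)) K p * 1 ∈
          (𝔭 : FractionalIdeal (endOrder (Algebra.leftMulMatrix μ))⁰ K) * M :=
        mul_mem_mul ((mem_coeIdeal _).2 ⟨p, hp𝔭, rfl⟩) h1M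
      rw [mul_one, ← mem_coe, hb, Submodule.mem_bot] at hmem
      exact hp0 (FaithfulSMul.algebraMap_injective _ _ (by rw [hmem, map_zero]))
    refine NumberRing.smul_ne_self_of_fg (K := K) h𝔭.ne_top
      (fg_of_isNoetherianRing le_rfl ((𝔭 : FractionalIdeal (endOrder (Algebra.leftMulMatrix μ))⁰ K) * M)) hPM0 ?_
    rw [← NumberRing.coe_coeIdeal_mul]
    exact congr_arg _ heq
  set 𝔮 : Ideal (endOrder (Algebra.leftMulMatrix μ)) :=
    ((Ideal.span {x} : Ideal (endOrder (Algebra.leftMulMatrix μ))).map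
      (algebraMap _ (Localization.AtPrime 𝔭))).comap (algebraMap _ (Localization.AtPrime 𝔭)) with h𝔮def
  have h𝔮u : IsUnit (𝔮 : FractionalIdeal (endOrder (Algebra.leftMulMatrix μ))⁰ K) :=
    NumberRing.isUnit_coeIdeal_comap_map_span_singleton (K := K) hx0 ⟨𝔭, h𝔭⟩
  have h𝔮M : (𝔮 : FractionalIdeal (endOrder (Algebra.leftMulMatrix μ))⁰ K) * M =
      (𝔭 : FractionalIdeal (endOrder (Algebra.leftMulMatrix μ))⁰ K) * M :=
    NumberRing.coeIdeal_comap_map_span_singleton_mul_eq hx0 hx hsup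
  have h𝔮𝔭 : 𝔮 ≤ 𝔭 := NumberRing.comap_map_le_of_le ((Ideal.span_singleton_le_iff_mem _).2 hx)
  -- (c) `#(I/𝔮I) = #(M/𝔮M)`, (d) `#(M/𝔮M) = #(M/𝔭M)`
  have hA := natCard_quotient_smul_top_eq_of_isUnit μ h𝔮u hI hM0
  have hB : Nat.card (↥(M : Submodule (endOrder (Algebra.leftMulMatrix μ)) K) ⧸
        (𝔮 • ⊤ : Submodule (endOrder (Algebra.leftMulMatrix μ)) (M : Submodule (endOrder (Algebra.leftMulMatrix μ)) K))) =
      Nat.card (↥(M : Submodule (endOrder (Algebra.leftMulMatrix μ)) K) ⧸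
        (𝔭 • ⊤ : Submodule (endOrder (Algebra.leftMulMatrix μ)) (M : Submodule (endOrder (Algebra.leftMulMatrix μ)) K))) := by
    rw [← natCard_quotient_comap_coeIdeal_mul μ 𝔮 M, ← natCard_quotient_comap_coeIdeal_mul μ 𝔭 M, h𝔮M]
  -- the target `M/𝔭M` is a finite `k`-space with `q = #k > 1` elements in the base field
  letI : Field (endOrder (Algebra.leftMulMatrix μ) ⧸ 𝔭) := Ideal.Quotient.field 𝔭
  haveI hfinM := NumberRing.finite_quotient_smul_top (K := K) 𝔭 (fg_of_isNoetherianRing le_rfl M)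
  haveI hfinI := NumberRing.finite_quotient_smul_top (K := K) 𝔭 (fg_of_isNoetherianRing le_rfl I)
  haveI : Finite (endOrder (Algebra.leftMulMatrix μ) ⧸ 𝔭) := finite_quotient_endOrder _ h0
  haveI : Finite (↥(M : Submodule (endOrder (Algebra.leftMulMatrix μ)) K) ⧸
      (𝔭 • ⊤ : Submodule (endOrder (Algebra.leftMulMatrix μ)) (M : Submodule (endOrder (Algebra.leftMulMatrix μ)) K))) :=
    Module.finite_of_finite (endOrder (Algebra.leftMulMatrix μ) ⧸ 𝔭)
  have hne : Nat.card (↥(I : Submodule (endOrder (Algebra.leftMulMatrix μ)) K) ⧸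
      (𝔮 • ⊤ : Submodule (endOrder (Algebra.leftMulMatrix μ)) (I : Submodule (endOrder (Algebra.leftMulMatrix μ)) K))) ≠ 0 := by
    rw [hA, hB]
    exact Nat.card_pos.ne'
  haveI := Nat.finite_of_card_ne_zero hne
  -- (e) `#(I/𝔭I) ≤ #(I/𝔮I)` since `𝔮I ⊆ 𝔭I`
  have hC : Nat.card (↥(I : Submodule (endOrder (Algebra.leftMulMatrix μ)) K) ⧸
        (𝔭 • ⊤ : Submodule (endOrder (Algebra.leftMulMatrix μ)) (I : Submodule (endOrder (Algebra.leftMulMatrix μ)) K))) ≤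
      Nat.card (↥(I : Submodule (endOrder (Algebra.leftMulMatrix μ)) K) ⧸
        (𝔮 • ⊤ : Submodule (endOrder (Algebra.leftMulMatrix μ)) (I : Submodule (endOrder (Algebra.leftMulMatrix μ)) K))) :=
    Nat.card_le_card_of_surjective _ (Submodule.factor_surjective (Submodule.smul_mono_left h𝔮𝔭))
  -- (f) compare exponents of `q`
  have key := hC.trans (hA.trans hB).le
  rw [Module.natCard_eq_pow_finrank (K := endOrder (Algebra.leftMulMatrix μ) ⧸ 𝔭)
      (V := ↥(I : Submodule (endOrder (Algebra.leftMulMatrix μ)) K) ⧸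
        (𝔭 • ⊤ : Submodule (endOrder (Algebra.leftMulMatrix μ)) (I : Submodule (endOrder (Algebra.leftMulMatrix μ)) K))),
    Module.natCard_eq_pow_finrank (K := endOrder (Algebra.leftMulMatrix μ) ⧸ 𝔭)
      (V := ↥(M : Submodule (endOrder (Algebra.leftMulMatrix μ)) K) ⧸
        (𝔭 • ⊤ : Submodule (endOrder (Algebra.leftMulMatrix μ)) (M : Submodule (endOrder (Algebra.leftMulMatrix μ)) K)))] at key
  exact (pow_le_pow_iff_right₀ (one_lt_natCard_quotient μ h0 h𝔭.ne_top)).1 key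

end LocalInequality

end CMTypeLattice

namespace NumberRing

/-! ## §3 Superficial elements exist under binary branching (any Dedekind domain) -/

section Dedekind

variable {R D : Type*} [CommRing R] [CommRing D] [IsDedekindDomain D] (f : R →+* D)

/-- **For `s ∈ 𝔭` and `J = 𝔭D ≠ 0` in a Dedekind domain `D`: either `s` is superficial, `J ⊆ f(s)D + J²`, or
`f(s) ∈ J𝔔` for some maximal ideal `𝔔 ⊇ J`** (write `f(s)D + J² = JC` with `J ∣ f(s)D + J² ⊆ J`; if `C ≠ D` take a
maximal `𝔔 ⊇ C`; `J² ⊆ J𝔔` forces `J ⊆ 𝔔` by cancellation).  The mechanism behind «`mS = ∏ nᵢ^{eᵢ}`»: `f(s)`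
generates `J` locally at `𝔔` iff `f(s) ∉ J𝔔`. [cite: Greither1982TwoGenerator, §2 Thm. 2.1 (proof: «As `S` is normal
and onedimensional, every nonzero ideal of `S` is a product of maximal ideals, so we get: `mS = ∏ nᵢ^{eᵢ}`»), p. 267] -/
theorem le_span_singleton_sup_sq_or_exists_mem_mul {𝔭 : Ideal R} (hJ0 : 𝔭.map f ≠ ⊥) {s : R} (hs : s ∈ 𝔭) :
    𝔭.map f ≤ Ideal.span {f s} ⊔ 𝔭.map f ^ 2 ∨
      ∃ Q : Ideal D, Q.IsMaximal ∧ 𝔭.map f ≤ Q ∧ f s ∈ 𝔭.map f * Q := by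
  classical
  set J := 𝔭.map f with hJ
  by_cases hle : J ≤ Ideal.span {f s} ⊔ J ^ 2
  · exact Or.inl hle
  right
  have hsJ : f s ∈ J := Ideal.mem_map_of_mem f hs
  have hAJ : Ideal.span {f s} ⊔ J ^ 2 ≤ J :=
    sup_le ((Ideal.span_singleton_le_iff_mem _).2 hsJ) (by rw [pow_two]; exact Ideal.mul_le_right)
  obtain ⟨C, hC⟩ := Ideal.dvd_iff_le.2 hAJ
  have hCtop : C ≠ ⊤ := fun h ↦ hle (by rw [hC, h, Ideal.mul_top])
  obtain ⟨Q, hQ, hCQ⟩ := Ideal.exists_le_maximal C hCtop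
  have hAQ : Ideal.span {f s} ⊔ J ^ 2 ≤ J * Q := hC ▸ Ideal.mul_mono_right hCQ
  refine ⟨Q, hQ, ?_, hAQ (Ideal.mem_sup_left (Ideal.mem_span_singleton_self _))⟩
  -- `J² ≤ JQ` forces `J ≤ Q` (cancel the nonzero ideal `J`)
  have h2 : J * J ≤ J * Q := le_trans (by rw [← pow_two]; exact le_sup_right) hAQ
  have hdvd : J * Q ∣ J * J := Ideal.dvd_iff_le.2 h2
  exact Ideal.le_of_dvd ((mul_dvd_mul_iff_left hJ0).1 hdvd)

/-- **No maximal ideal `𝔔` swallows all of `f(𝔭)`: some `t ∈ 𝔭` has `f(t) ∉ J𝔔`** (`J = 𝔭D ≠ 0`; otherwise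
`J ⊆ J𝔔`, i.e. `D ⊆ 𝔔` after cancelling `J`) — the generators of `J` coming from `𝔭` generate `J` locally at `𝔔`.
[cite: Greither1982TwoGenerator, §2 Thm. 2.1 (proof), p. 267] -/
theorem exists_mem_map_not_mem_mul {𝔭 : Ideal R} (hJ0 : 𝔭.map f ≠ ⊥) {Q : Ideal D} (hQ : Q.IsMaximal) :
    ∃ t ∈ 𝔭, f t ∉ 𝔭.map f * Q := by
  by_contra h
  push Not at h
  have hle : 𝔭.map f ≤ 𝔭.map f * Q := by
    rw [Ideal.map, Ideal.span_le]
    rintro _ ⟨t, ht, rfl⟩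
    exact h t ht
  have hdvd : 𝔭.map f * Q ∣ 𝔭.map f * ⊤ := by rw [Ideal.mul_top]; exact Ideal.dvd_iff_le.2 hle
  have := Ideal.le_of_dvd ((mul_dvd_mul_iff_left hJ0).1 hdvd)
  exact hQ.ne_top (top_le_iff.1 this)

/-- **SUPERFICIAL ELEMENTS EXIST UNDER BINARY BRANCHING: if among any three maximal ideals of the Dedekind domain `D`
containing `J = 𝔭D ≠ 0` two coincide («over `𝔭` there are at most two primes of `S`»), then some `x ∈ 𝔭` has
`J ⊆ f(x)D + J²`** — i.e. `f(x)` generates `J` locally at every prime, `xS_𝔭 = mS_𝔭` in Greither's notation.  Proof: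
otherwise every `s ∈ 𝔭` lies in `J𝔔` for one of the (at most two) maximal `𝔔 ⊇ J`, and `𝔭` would be the union of
two proper subgroups `{s : f(s) ∈ J𝔔₀}`, `{s : f(s) ∈ J𝔔₁}` (take `t₁ ∉ J𝔔₀`, `t₂ ∉ J𝔔₁`, and look at `t₁ + t₂`).
No condition on the residue field is needed for at most two primes; for three or more primes over a finite
residue field such an `x ∈ 𝔭` may fail to exist (the printed proof then extends the residue field).
[cite: Greither1982TwoGenerator, §2 Thm. 2.1 (proof) and Thm. 2.3 («`R` has binary branching if over every
`p ∈ Spec(R)` there are at most two primes of `S`»), pp. 267–268] -/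
theorem exists_mem_map_le_span_singleton_sup_sq {𝔭 : Ideal R} (hJ0 : 𝔭.map f ≠ ⊥)
    (h3 : ∀ Q₁ Q₂ Q₃ : Ideal D, Q₁.IsMaximal → Q₂.IsMaximal → Q₃.IsMaximal →
      𝔭.map f ≤ Q₁ → 𝔭.map f ≤ Q₂ → 𝔭.map f ≤ Q₃ → Q₁ = Q₂ ∨ Q₁ = Q₃ ∨ Q₂ = Q₃) :
    ∃ x ∈ 𝔭, 𝔭.map f ≤ Ideal.span {f x} ⊔ 𝔭.map f ^ 2 := by
  by_contra hcon
  push Not at hcon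
  have hA : ∀ s ∈ 𝔭, ∃ Q : Ideal D, Q.IsMaximal ∧ 𝔭.map f ≤ Q ∧ f s ∈ 𝔭.map f * Q := fun s hs ↦
    (le_span_singleton_sup_sq_or_exists_mem_mul f hJ0 hs).resolve_left (hcon s hs)
  obtain ⟨Q₀, hQ₀, hJQ₀, -⟩ := hA 0 𝔭.zero_mem
  obtain ⟨t₁, ht₁, ht₁Q₀⟩ := exists_mem_map_not_mem_mul f hJ0 hQ₀
  obtain ⟨Q₁, hQ₁, hJQ₁, ht₁Q₁⟩ := hA t₁ ht₁
  have h01 : Q₀ ≠ Q₁ := by rintro rfl; exact ht₁Q₀ ht₁Q₁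
  obtain ⟨t₂, ht₂, ht₂Q₁⟩ := exists_mem_map_not_mem_mul f hJ0 hQ₁
  obtain ⟨Q₂, hQ₂, hJQ₂, ht₂Q₂⟩ := hA t₂ ht₂
  have ht₂Q₀ : f t₂ ∈ 𝔭.map f * Q₀ := by
    rcases h3 Q₀ Q₁ Q₂ hQ₀ hQ₁ hQ₂ hJQ₀ hJQ₁ hJQ₂ with h | h | h
    · exact absurd h h01
    · rw [h]; exact ht₂Q₂
    · rw [h] at ht₂Q₁; exact absurd ht₂Q₂ ht₂Q₁
  obtain ⟨Q₃, hQ₃, hJQ₃, ht₃Q₃⟩ := hA (t₁ + t₂) (𝔭.add_mem ht₁ ht₂)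
  rw [map_add] at ht₃Q₃
  rcases h3 Q₀ Q₁ Q₃ hQ₀ hQ₁ hQ₃ hJQ₀ hJQ₁ hJQ₃ with h | h | h
  · exact h01 h
  · rw [← h] at ht₃Q₃
    exact ht₁Q₀ ((Submodule.add_mem_iff_left _ ht₂Q₀).1 ht₃Q₃)
  · rw [← h] at ht₃Q₃
    exact ht₂Q₁ ((Submodule.add_mem_iff_right _ ht₁Q₁).1 ht₃Q₃)

end Dedekind

end NumberRing

namespace EndOrder

/-! ## §4 Transport to the order `𝔯 = endOrder ρ` along `I ↦ I𝒪_K` -/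

section Transport

variable {K : Type} [Field K] [NumberField K]
variable {ι : Type} [Fintype ι] [DecidableEq ι] [Nonempty ι] {ρ : K →ₐ[ℚ] Matrix ι ι ℚ}
variable [IsFractionRing (endOrder ρ) K]

/-- **`M·𝒪_K = 𝒪_K`** for the maximal order `M` (`↑M = 𝒪_K`) under the tree's extension map `EndOrder.extend ρ`
(bookkeeping). [cite: Stevenhagen2008NumberRings, §6 («`[I] ↦ [I𝒪]`»), p. 224] -/
theorem extend_eq_one_of_coe_eq_range {M : FractionalIdeal (endOrder ρ)⁰ K}
    (hMO : (M : Set K) = (algebraMap (𝓞 K) K).range) : extend ρ M = 1 := by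
  obtain ⟨hMMle, h1⟩ := mul_self_le_and_one_mem_of_coe_eq_range hMO
  have hMM := mul_self_eq_of_one_mem_of_mul_self_le h1 hMMle
  have hst := (mul_eq_iff_forall_mul_mem_of_coe_eq_range hMO).1 hMM
  apply SetLike.coe_injective
  rw [coe_extend_eq_of_forall_mul_mem hst, hMO]
  ext y
  simp only [RingHom.coe_range, Set.mem_range, SetLike.mem_coe, mem_one_iff]

/-- **`𝒪_K`-stable fractional `𝔯`-ideals compare through their extensions: `N₁𝒪_K ⊆ N₂𝒪_K ⟹ N₁ ⊆ N₂`** when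
`MN₁ = N₁`, `MN₂ = N₂` (their carriers are unchanged by `· 𝒪_K`; bookkeeping). [cite: Marseglia2019, §2 («a fractional
`R`-ideal `I` is also an `S`-ideal … if and only if `IS = I`»), p. 4] -/
theorem le_of_extend_le_extend {M N₁ N₂ : FractionalIdeal (endOrder ρ)⁰ K}
    (hMO : (M : Set K) = (algebraMap (𝓞 K) K).range) (h₁ : M * N₁ = N₁) (h₂ : M * N₂ = N₂)
    (h : extend ρ N₁ ≤ extend ρ N₂) : N₁ ≤ N₂ := by
  intro y hy
  have hy' : y ∈ ((extend ρ N₁ : FractionalIdeal (𝓞 K)⁰ K) : Set K) := by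
    rw [coe_extend_eq_of_forall_mul_mem ((mul_eq_iff_forall_mul_mem_of_coe_eq_range hMO).1 h₁)]
    exact hy
  have hy'' : y ∈ ((extend ρ N₂ : FractionalIdeal (𝓞 K)⁰ K) : Set K) := h hy'
  rw [coe_extend_eq_of_forall_mul_mem ((mul_eq_iff_forall_mul_mem_of_coe_eq_range hMO).1 h₂)] at hy''
  exact hy''

/-- **A superficial element read in `𝓞 K` is superficial in the order's vocabulary: `𝔭𝒪_K ⊆ x𝒪_K + (𝔭𝒪_K)²` in
`Ideal (𝓞 K)` gives `𝔭M ⊆ xM + 𝔭²M` for the fractional `𝔯`-ideals** (`extend` is a ring homomorphism with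
`(𝔞 : 𝔯-ideal) ↦ 𝔞𝒪_K`, `M ↦ 𝒪_K`; both sides are `𝒪_K`-stable). [cite: Stevenhagen2008NumberRings, §6, p. 224]
[cite: Greither1982TwoGenerator, §2 Thm. 2.1 (proof), p. 267] -/
theorem coeIdeal_mul_le_of_map_le_span_singleton_sup_sq {M : FractionalIdeal (endOrder ρ)⁰ K}
    (hMO : (M : Set K) = (algebraMap (𝓞 K) K).range) {𝔭 : Ideal (endOrder ρ)} {x : endOrder ρ}
    (h : 𝔭.map (toRingOfIntegers ρ) ≤
      Ideal.span {toRingOfIntegers ρ x} ⊔ 𝔭.map (toRingOfIntegers ρ) ^ 2) :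
    (𝔭 : FractionalIdeal (endOrder ρ)⁰ K) * M ≤
      ((Ideal.span {x} : Ideal (endOrder ρ)) : FractionalIdeal (endOrder ρ)⁰ K) * M +
        (𝔭 : FractionalIdeal (endOrder ρ)⁰ K) ^ 2 * M := by
  obtain ⟨hMMle, h1⟩ := mul_self_le_and_one_mem_of_coe_eq_range hMO
  have hMM := mul_self_eq_of_one_mem_of_mul_self_le h1 hMMle
  have hst₁ : M * ((𝔭 : FractionalIdeal (endOrder ρ)⁰ K) * M) = (𝔭 : FractionalIdeal (endOrder ρ)⁰ K) * M := by
    rw [mul_left_comm, hMM]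
  have hst₂ : M * (((Ideal.span {x} : Ideal (endOrder ρ)) : FractionalIdeal (endOrder ρ)⁰ K) * M +
        (𝔭 : FractionalIdeal (endOrder ρ)⁰ K) ^ 2 * M) =
      ((Ideal.span {x} : Ideal (endOrder ρ)) : FractionalIdeal (endOrder ρ)⁰ K) * M +
        (𝔭 : FractionalIdeal (endOrder ρ)⁰ K) ^ 2 * M := by
    rw [mul_add, mul_left_comm, hMM, mul_left_comm M, hMM]
  refine le_of_extend_le_extend hMO hst₁ hst₂ ?_
  have hspan : (Ideal.span {x} : Ideal (endOrder ρ)).map (toRingOfIntegers ρ) = Ideal.span {toRingOfIntegers ρ x} := by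
    rw [Ideal.map_span, Set.image_singleton]
  rw [map_add, map_mul, map_mul, map_mul, map_pow, extend_eq_one_of_coe_eq_range hMO, mul_one, mul_one, mul_one,
    extend_coeIdeal, extend_coeIdeal, hspan, ← coeIdeal_pow, ← coeIdeal_sup, coeIdeal_le_coeIdeal]
  exact h

omit [IsFractionRing (endOrder ρ) K] in
/-- The extended ideal `𝔭𝒪_K` of a nonzero ideal `𝔭` of the order is nonzero (`𝔯 → 𝓞 K` is injective; plumbing).
[cite: Stevenhagen2008NumberRings, §6 (the inclusion `R → 𝒪`), p. 224] -/
theorem map_toRingOfIntegers_ne_bot {𝔭 : Ideal (endOrder ρ)} (h0 : 𝔭 ≠ ⊥) : 𝔭.map (toRingOfIntegers ρ) ≠ ⊥ :=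
  fun h ↦ h0 ((Ideal.map_eq_bot_iff_of_injective (toRingOfIntegers_injective ρ)).1 h)

/-- **BINARY BRANCHING AT `𝔭` ⟹ A SUPERFICIAL ELEMENT: if at most two primes of `𝒪_K` lie over the nonzero ideal `𝔭`
of the order `𝔯 = endOrder ρ`, there is `x ∈ 𝔭` with `𝔭𝒪_K ⊆ x𝒪_K + 𝔭²𝒪_K`** (§3 in `𝓞 K`, transported by §4).
[cite: Greither1982TwoGenerator, §2 Thm. 2.1 (proof) and Thm. 2.3 (binary branching), pp. 267–268] -/
theorem exists_mem_coeIdeal_mul_le_of_binaryBranching {M : FractionalIdeal (endOrder ρ)⁰ K}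
    (hMO : (M : Set K) = (algebraMap (𝓞 K) K).range) {𝔭 : Ideal (endOrder ρ)} (h0 : 𝔭 ≠ ⊥)
    (h3 : ∀ Q₁ Q₂ Q₃ : Ideal (𝓞 K), Q₁.IsMaximal → Q₂.IsMaximal → Q₃.IsMaximal →
      𝔭.map (toRingOfIntegers ρ) ≤ Q₁ → 𝔭.map (toRingOfIntegers ρ) ≤ Q₂ → 𝔭.map (toRingOfIntegers ρ) ≤ Q₃ →
      Q₁ = Q₂ ∨ Q₁ = Q₃ ∨ Q₂ = Q₃) :
    ∃ x ∈ 𝔭, (𝔭 : FractionalIdeal (endOrder ρ)⁰ K) * M ≤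
      ((Ideal.span {x} : Ideal (endOrder ρ)) : FractionalIdeal (endOrder ρ)⁰ K) * M +
        (𝔭 : FractionalIdeal (endOrder ρ)⁰ K) ^ 2 * M := by
  obtain ⟨x, hx, h⟩ := NumberRing.exists_mem_map_le_span_singleton_sup_sq (toRingOfIntegers ρ)
    (map_toRingOfIntegers_ne_bot h0) h3
  exact ⟨x, hx, coeIdeal_mul_le_of_map_le_span_singleton_sup_sq hMO h⟩

end Transport

end EndOrder

namespace CMTypeLattice

/-! ## §5 GREITHER'S THEOREM 2.1 under binary branching; MARSEGLIA'S LEMMA 4.3 and COROLLARY 4.4 -/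

section Consequences

variable {K : Type} [Field K] [NumberField K]
variable {ι : Type} [Fintype ι] [DecidableEq ι] (μ : Basis ι ℚ K) [Nonempty ι]
variable [IsFractionRing (endOrder (Algebra.leftMulMatrix μ)) K]

/-- **GREITHER'S THEOREM 2.1 (`v(I) ≤ [S/mS : R/m]`) AT A PRIME WITH BINARY BRANCHING: if at most two primes of `𝒪_K`
lie over the maximal ideal `𝔭` of `S = endOrder (M_μ)`, then `dim_{S/𝔭} I/𝔭I ≤ dim_{S/𝔭} 𝒪_K/𝔭𝒪_K` for every
fractional `S`-ideal `I ≠ 0`.** [cite: Greither1982TwoGenerator, §2 Thm. 2.1 and Thm. 2.3, pp. 267–268]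
[cite: Marseglia2024CMType, §4 Lemma 4.3, p. 10] -/
theorem finrank_quotient_smul_top_le_of_binaryBranching {M : FractionalIdeal (endOrder (Algebra.leftMulMatrix μ))⁰ K}
    (hMO : (M : Set K) = (algebraMap (𝓞 K) K).range) {𝔭 : Ideal (endOrder (Algebra.leftMulMatrix μ))}
    [h𝔭 : 𝔭.IsMaximal]
    (h3 : ∀ Q₁ Q₂ Q₃ : Ideal (𝓞 K), Q₁.IsMaximal → Q₂.IsMaximal → Q₃.IsMaximal →
      𝔭.map (EndOrder.toRingOfIntegers (Algebra.leftMulMatrix μ)) ≤ Q₁ →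
      𝔭.map (EndOrder.toRingOfIntegers (Algebra.leftMulMatrix μ)) ≤ Q₂ →
      𝔭.map (EndOrder.toRingOfIntegers (Algebra.leftMulMatrix μ)) ≤ Q₃ → Q₁ = Q₂ ∨ Q₁ = Q₃ ∨ Q₂ = Q₃)
    {I : FractionalIdeal (endOrder (Algebra.leftMulMatrix μ))⁰ K} (hI : I ≠ 0) :
    Module.finrank (endOrder (Algebra.leftMulMatrix μ) ⧸ 𝔭)
        (↥(I : Submodule (endOrder (Algebra.leftMulMatrix μ)) K) ⧸
          (𝔭 • ⊤ : Submodule (endOrder (Algebra.leftMulMatrix μ)) (I : Submodule (endOrder (Algebra.leftMulMatrix μ)) K))) ≤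
      Module.finrank (endOrder (Algebra.leftMulMatrix μ) ⧸ 𝔭)
        (↥(M : Submodule (endOrder (Algebra.leftMulMatrix μ)) K) ⧸
          (𝔭 • ⊤ : Submodule (endOrder (Algebra.leftMulMatrix μ)) (M : Submodule (endOrder (Algebra.leftMulMatrix μ)) K))) := by
  have h0 : 𝔭 ≠ ⊥ := Ring.ne_bot_of_isMaximal_of_not_isField h𝔭 EndOrder.not_isField
  obtain ⟨x, hx, hsup⟩ := EndOrder.exists_mem_coeIdeal_mul_le_of_binaryBranching hMO h0 h3
  exact finrank_quotient_smul_top_le_of_superficial μ hMO hx hsup hI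

/-- **MARSEGLIA 2024 LEMMA 4.3 ([Greither82]), «`gens(S) ≤ max{2, gens_S(𝒪_K)}`», ideal by ideal, for an order with
binary branching at its non-invertible primes: `gens_S(I) ≤ max{2, gens_S(𝒪_K)}` for every fractional ideal `I ≠ 0`**
(LEMMA 4.2: `gens_S(I) ≤ max{2, max_𝔭 dim I/𝔭I}`; `dim I/𝔭I = 1` at invertible primes and `≤ dim 𝒪_K/𝔭𝒪_K ≤ gens_S(𝒪_K)`
at the others) — GREITHER'S COROLLARY 2.2 «`v(R) ≤ max(2, minimal number of generators of S as an R-module)`».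
[cite: Marseglia2024CMType, §4 Lemma 4.3, p. 10] [cite: Greither1982TwoGenerator, §2 Cor. 2.2, p. 268] -/
theorem spanFinrank_coe_le_max_of_binaryBranching {M : FractionalIdeal (endOrder (Algebra.leftMulMatrix μ))⁰ K}
    (hMO : (M : Set K) = (algebraMap (𝓞 K) K).range)
    (h3 : ∀ 𝔭 : MaximalSpectrum (endOrder (Algebra.leftMulMatrix μ)),
      ¬ IsUnit (𝔭.asIdeal : FractionalIdeal (endOrder (Algebra.leftMulMatrix μ))⁰ K) →
      ∀ Q₁ Q₂ Q₃ : Ideal (𝓞 K), Q₁.IsMaximal → Q₂.IsMaximal → Q₃.IsMaximal →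
        𝔭.asIdeal.map (EndOrder.toRingOfIntegers (Algebra.leftMulMatrix μ)) ≤ Q₁ →
        𝔭.asIdeal.map (EndOrder.toRingOfIntegers (Algebra.leftMulMatrix μ)) ≤ Q₂ →
        𝔭.asIdeal.map (EndOrder.toRingOfIntegers (Algebra.leftMulMatrix μ)) ≤ Q₃ → Q₁ = Q₂ ∨ Q₁ = Q₃ ∨ Q₂ = Q₃)
    {I : FractionalIdeal (endOrder (Algebra.leftMulMatrix μ))⁰ K} (hI : I ≠ 0) :
    (I : Submodule (endOrder (Algebra.leftMulMatrix μ)) K).spanFinrank ≤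
      max 2 (M : Submodule (endOrder (Algebra.leftMulMatrix μ)) K).spanFinrank := by
  obtain ⟨n, hn⟩ : ∃ n, max 2 (M : Submodule (endOrder (Algebra.leftMulMatrix μ)) K).spanFinrank = n + 1 + 1 :=
    ⟨max 2 (M : Submodule (endOrder (Algebra.leftMulMatrix μ)) K).spanFinrank - 2, by omega⟩
  rw [hn]
  refine EndOrder.spanFinrank_le_of_forall_finrank_quotient_le hI (by omega) fun 𝔭 ↦ ?_
  haveI := 𝔭.isMaximal
  rw [← hn]
  by_cases hu : IsUnit (𝔭.asIdeal : FractionalIdeal (endOrder (Algebra.leftMulMatrix μ))⁰ K)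
  · rw [EndOrder.finrank_quotient_eq_one_of_isUnit_coeIdeal (asIdeal_ne_bot μ 𝔭) hu hI]
    exact le_max_of_le_left one_le_two
  · exact (finrank_quotient_smul_top_le_of_binaryBranching μ hMO (h3 𝔭 hu) hI).trans
      (le_max_of_le_right (EndOrder.finrank_quotient_smul_top_le_spanFinrank M (asIdeal_ne_bot μ 𝔭)))

/-- **MARSEGLIA 2024 COROLLARY 4.4, first equality «`gens(S) = gens_S(𝒪_K)`» for a non-maximal order `S` with
binary branching at its non-invertible primes** (`≤` is LEMMA 4.3 with «Since `S ≠ 𝒪_K` then `gens_S(𝒪_K) ≥ 2`»;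
`≥` is DEFINITION 4.1) — GREITHER'S COROLLARY 2.2, equality case «if `v(R) ≠ 1` … we have equality».
[cite: Marseglia2024CMType, §4 Cor. 4.4, p. 10] [cite: Greither1982TwoGenerator, §2 Cor. 2.2, p. 268] -/
theorem iSup_spanFinrank_coe_eq_spanFinrank_coe_of_binaryBranching
    {M : FractionalIdeal (endOrder (Algebra.leftMulMatrix μ))⁰ K}
    (hMO : (M : Set K) = (algebraMap (𝓞 K) K).range)
    (hS : ∃ a : 𝓞 K, (a : K) ∉ endOrder (Algebra.leftMulMatrix μ))
    (h3 : ∀ 𝔭 : MaximalSpectrum (endOrder (Algebra.leftMulMatrix μ)),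
      ¬ IsUnit (𝔭.asIdeal : FractionalIdeal (endOrder (Algebra.leftMulMatrix μ))⁰ K) →
      ∀ Q₁ Q₂ Q₃ : Ideal (𝓞 K), Q₁.IsMaximal → Q₂.IsMaximal → Q₃.IsMaximal →
        𝔭.asIdeal.map (EndOrder.toRingOfIntegers (Algebra.leftMulMatrix μ)) ≤ Q₁ →
        𝔭.asIdeal.map (EndOrder.toRingOfIntegers (Algebra.leftMulMatrix μ)) ≤ Q₂ →
        𝔭.asIdeal.map (EndOrder.toRingOfIntegers (Algebra.leftMulMatrix μ)) ≤ Q₃ → Q₁ = Q₂ ∨ Q₁ = Q₃ ∨ Q₂ = Q₃) :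
    ⨆ I : {I : FractionalIdeal (endOrder (Algebra.leftMulMatrix μ))⁰ K // I ≠ 0},
        ((I : FractionalIdeal (endOrder (Algebra.leftMulMatrix μ))⁰ K) :
          Submodule (endOrder (Algebra.leftMulMatrix μ)) K).spanFinrank =
      (M : Submodule (endOrder (Algebra.leftMulMatrix μ)) K).spanFinrank := by
  have h2 := two_le_spanFinrank_coe_of_exists_not_mem μ hMO hS
  have hM0 := ne_zero_of_coe_eq_range μ hMO
  haveI : Nonempty {I : FractionalIdeal (endOrder (Algebra.leftMulMatrix μ))⁰ K // I ≠ 0} := ⟨⟨M, hM0⟩⟩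
  refine le_antisymm (ciSup_le fun I ↦ ?_) (spanFinrank_coe_le_iSup μ hM0)
  exact (spanFinrank_coe_le_max_of_binaryBranching μ hMO h3 I.2).trans (max_le h2 le_rfl)

/-- **COROLLARY 4.4 in full for such an order: `gens(S) = gens_S(𝒪_K) = max_𝔭 dim_{S/𝔭} 𝒪_K/𝔭𝒪_K`** (the second
equality is g28-#8's `spanFinrank_coe_eq_iSup_finrank_quotient_smul_top`) — GREITHER's global form of THEOREM 2.1
through LEMMA 1.3. [cite: Marseglia2024CMType, §4 Cor. 4.4, p. 10] [cite: Greither1982TwoGenerator, §1 Lemma 1.3 and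
§2 Thm. 2.1 / Cor. 2.2, pp. 267–268] -/
theorem iSup_spanFinrank_coe_eq_iSup_finrank_quotient_smul_top_of_binaryBranching
    {M : FractionalIdeal (endOrder (Algebra.leftMulMatrix μ))⁰ K}
    (hMO : (M : Set K) = (algebraMap (𝓞 K) K).range)
    (hS : ∃ a : 𝓞 K, (a : K) ∉ endOrder (Algebra.leftMulMatrix μ))
    (h3 : ∀ 𝔭 : MaximalSpectrum (endOrder (Algebra.leftMulMatrix μ)),
      ¬ IsUnit (𝔭.asIdeal : FractionalIdeal (endOrder (Algebra.leftMulMatrix μ))⁰ K) →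
      ∀ Q₁ Q₂ Q₃ : Ideal (𝓞 K), Q₁.IsMaximal → Q₂.IsMaximal → Q₃.IsMaximal →
        𝔭.asIdeal.map (EndOrder.toRingOfIntegers (Algebra.leftMulMatrix μ)) ≤ Q₁ →
        𝔭.asIdeal.map (EndOrder.toRingOfIntegers (Algebra.leftMulMatrix μ)) ≤ Q₂ →
        𝔭.asIdeal.map (EndOrder.toRingOfIntegers (Algebra.leftMulMatrix μ)) ≤ Q₃ → Q₁ = Q₂ ∨ Q₁ = Q₃ ∨ Q₂ = Q₃) :
    ⨆ I : {I : FractionalIdeal (endOrder (Algebra.leftMulMatrix μ))⁰ K // I ≠ 0},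
        ((I : FractionalIdeal (endOrder (Algebra.leftMulMatrix μ))⁰ K) :
          Submodule (endOrder (Algebra.leftMulMatrix μ)) K).spanFinrank =
      ⨆ 𝔭 : MaximalSpectrum (endOrder (Algebra.leftMulMatrix μ)),
        Module.finrank (endOrder (Algebra.leftMulMatrix μ) ⧸ 𝔭.asIdeal)
          (↥(M : Submodule (endOrder (Algebra.leftMulMatrix μ)) K) ⧸
            (𝔭.asIdeal • ⊤ : Submodule (endOrder (Algebra.leftMulMatrix μ))
              (M : Submodule (endOrder (Algebra.leftMulMatrix μ)) K))) := by
  rw [iSup_spanFinrank_coe_eq_spanFinrank_coe_of_binaryBranching μ hMO hS h3,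
    spanFinrank_coe_eq_iSup_finrank_quotient_smul_top μ hMO hS]

/-- **MARSEGLIA 2024 PROPOSITION 4.5, «In particular, if `S` is not maximal then
`gens(S) = 1 + max{type(S + 𝔭𝒪_K) : 𝔭 a prime of S}`», AS PRINTED (with `gens(S)` on the left), for an order with
binary branching at its non-invertible primes**: there is a non-invertible prime `𝔭` — any prime maximising
`dim_{S/𝔭} 𝒪_K/𝔭𝒪_K` — such that `type(T) + 1 = gens(S)` for every presentation `T = endOrder (M_ν)` of the over-order
`S + 𝔭𝒪_K` and its trace dual `↑T′ = Tᵗ` (g28-#8's `exists_not_isUnit_forall_iSup_add_one_eq_spanFinrank_coe`, which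
has `gens_S(𝒪_K)` on the right, combined with COROLLARY 4.4's first equality; `type(T′′) + 1 ≤ gens_S(𝒪_K)` at the
other non-invertible primes is g28-#8's `iSup_finrank_traceDual_quotient_add_one_le_spanFinrank_coe`).
[cite: Marseglia2024CMType, §4 Prop. 4.5 («In particular»), Cor. 4.4, p. 10] -/
theorem exists_not_isUnit_forall_iSup_add_one_eq_iSup_spanFinrank_of_binaryBranching
    {M : FractionalIdeal (endOrder (Algebra.leftMulMatrix μ))⁰ K}
    (hMO : (M : Set K) = (algebraMap (𝓞 K) K).range)
    (hS : ∃ a : 𝓞 K, (a : K) ∉ endOrder (Algebra.leftMulMatrix μ))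
    (h3 : ∀ 𝔭 : MaximalSpectrum (endOrder (Algebra.leftMulMatrix μ)),
      ¬ IsUnit (𝔭.asIdeal : FractionalIdeal (endOrder (Algebra.leftMulMatrix μ))⁰ K) →
      ∀ Q₁ Q₂ Q₃ : Ideal (𝓞 K), Q₁.IsMaximal → Q₂.IsMaximal → Q₃.IsMaximal →
        𝔭.asIdeal.map (EndOrder.toRingOfIntegers (Algebra.leftMulMatrix μ)) ≤ Q₁ →
        𝔭.asIdeal.map (EndOrder.toRingOfIntegers (Algebra.leftMulMatrix μ)) ≤ Q₂ →
        𝔭.asIdeal.map (EndOrder.toRingOfIntegers (Algebra.leftMulMatrix μ)) ≤ Q₃ → Q₁ = Q₂ ∨ Q₁ = Q₃ ∨ Q₂ = Q₃) :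
    ∃ 𝔭 : MaximalSpectrum (endOrder (Algebra.leftMulMatrix μ)),
      ¬ IsUnit (𝔭.asIdeal : FractionalIdeal (endOrder (Algebra.leftMulMatrix μ))⁰ K) ∧
      ∀ ν : Basis ι ℚ K, (∀ x : K, x ∈ endOrder (Algebra.leftMulMatrix ν) ↔
          ∃ s ∈ endOrder (Algebra.leftMulMatrix μ),
            ∃ y ∈ (𝔭.asIdeal : FractionalIdeal (endOrder (Algebra.leftMulMatrix μ))⁰ K) * M, x = s + y) →
        ∀ T' : FractionalIdeal (endOrder (Algebra.leftMulMatrix ν))⁰ K,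
          (T' : Submodule (endOrder (Algebra.leftMulMatrix ν)) K) =
            traceDual ℤ ℚ ((1 : FractionalIdeal (endOrder (Algebra.leftMulMatrix ν))⁰ K) :
              Submodule (endOrder (Algebra.leftMulMatrix ν)) K) →
          (⨆ 𝔔 : MaximalSpectrum (endOrder (Algebra.leftMulMatrix ν)),
              Module.finrank (endOrder (Algebra.leftMulMatrix ν) ⧸ 𝔔.asIdeal)
                ((T' : Submodule (endOrder (Algebra.leftMulMatrix ν)) K) ⧸
                  (𝔔.asIdeal • ⊤ : Submodule (endOrder (Algebra.leftMulMatrix ν))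
                    (T' : Submodule (endOrder (Algebra.leftMulMatrix ν)) K)))) + 1 =
            ⨆ I : {I : FractionalIdeal (endOrder (Algebra.leftMulMatrix μ))⁰ K // I ≠ 0},
              ((I : FractionalIdeal (endOrder (Algebra.leftMulMatrix μ))⁰ K) :
                Submodule (endOrder (Algebra.leftMulMatrix μ)) K).spanFinrank := by
  rw [iSup_spanFinrank_coe_eq_spanFinrank_coe_of_binaryBranching μ hMO hS h3]
  exact exists_not_isUnit_forall_iSup_add_one_eq_spanFinrank_coe μ hMO hS

end Consequences

end CMTypeLattice

end Literature.NumberTheory.ComplexMultiplication
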